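import Mathlib.Analysis.SpecificLimits.Normed

/-! # CRIT-2 g3 — S-1 in kernel form: the MODULUS toy WITH the `β′ = O(g)` prefactor is still not geometric

Companion to idea-5 g12's `…Idea5g12.marginalTransport_not_geomFading` (Sketch5 :1503, bare transport factor) and to
CRIT-1 g6's `Crit1ShiftOscToy.shiftOsc_not_geom` (oscillation twin).  Modulo H_FE′ + the transport identification (T) the
entry-0 history modulus of the record β at scale k is `≍ sup_{0<g₀≤γ₀} |β₁|·g₀·(1 + c k g₀²)^{-2}` (prefactor `β^{pr}′(g_k) = O(g_k)`
INCLUDED); this file proves the exact elementary fact that even with the prefactor the box-sup is not `O(ρ^k)`, `ρ < 1`: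
test point `g₀ := min γ₀ (c k + 1)⁻¹` gives the value `≥ g₀ ∕ 4 ≍ 1∕k`.  Real-analysis toy; no record β named; nothing of
Bałaban asserted; R4 = the conditional finite-𝕋⁴ rung only; the YM mass gap (Clay) is NOT proved. -/

open Filter Topology

namespace Summit.QuantumFields.YangMills.Cruxes.EndpointGivenBR13SepCoPH.Crit2ModulusPrefactorToy

/-- `C ρ^k (c k + 1) → 0` for `0 ≤ ρ < 1`. [folklore] -/
theorem tendsto_geom_mul_linear {C c ρ : ℝ} (hρ0 : 0 ≤ ρ) (hρ1 : ρ < 1) :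
    Tendsto (fun k : ℕ => C * ρ ^ k * (c * k + 1)) atTop (𝓝 0) := by
  have hab : |ρ| < 1 := by rwa [abs_of_nonneg hρ0]
  have h1 : Tendsto (fun k : ℕ => (k : ℝ) ^ 1 * ρ ^ k) atTop (𝓝 0) :=
    tendsto_pow_const_mul_const_pow_of_abs_lt_one 1 hab
  have h0 : Tendsto (fun k : ℕ => ρ ^ k) atTop (𝓝 0) := tendsto_pow_atTop_nhds_zero_of_lt_one hρ0 hρ1
  have h := (h1.const_mul (C * c)).add (h0.const_mul C)
  simp only [mul_zero, add_zero] at h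
  refine h.congr' (Eventually.of_forall fun k => ?_)
  simp only [pow_one]
  ring

/-- **S-1 (kernel form): the entry-0 modulus WITH the `O(g)` prefactor is not geometrically small.**  For `0 ≤ c`, `0 < γ₀` there are
no `C`, `0 ≤ ρ < 1` with `g₀ ∕ (1 + c k g₀²)² ≤ C ρ^k` for all `k` and all `g₀ ∈ ]0, γ₀]`. [folklore] -/
theorem modulusWithPrefactor_not_geom {c γ₀ : ℝ} (hc : 0 ≤ c) (hγ₀ : 0 < γ₀) :
    ¬ ∃ C ρ : ℝ, 0 ≤ ρ ∧ ρ < 1 ∧ ∀ (k : ℕ) (g₀ : ℝ), 0 < g₀ → g₀ ≤ γ₀ → g₀ / (1 + c * k * g₀ ^ 2) ^ 2 ≤ C * ρ ^ k := by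
  rintro ⟨C, ρ, hρ0, hρ1, h⟩
  have ht := tendsto_geom_mul_linear (C := C) (c := c) hρ0 hρ1
  have h0 : Tendsto (fun k : ℕ => C * ρ ^ k) atTop (𝓝 0) := by
    simpa using (tendsto_pow_atTop_nhds_zero_of_lt_one hρ0 hρ1).const_mul C
  obtain ⟨k, hk1, hk2⟩ : ∃ k : ℕ, C * ρ ^ k * (c * k + 1) < 1 / 4 ∧ C * ρ ^ k < γ₀ / 4 :=
    ((ht.eventually (gt_mem_nhds (by norm_num : (0 : ℝ) < 1 / 4))).and
      (h0.eventually (gt_mem_nhds (by positivity : (0 : ℝ) < γ₀ / 4)))).exists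
  have hk0 : (0 : ℝ) ≤ k := k.cast_nonneg
  have hck1 : 0 < c * k + 1 := by positivity
  set g₀ : ℝ := min γ₀ (c * k + 1)⁻¹ with hg₀
  have hg₀pos : 0 < g₀ := lt_min hγ₀ (inv_pos.2 hck1)
  have hg₀le : g₀ ≤ γ₀ := min_le_left _ _
  have hg₀inv : g₀ ≤ (c * k + 1)⁻¹ := min_le_right _ _
  -- `c k g₀² ≤ 1`, hence the denominator is at most `4`
  have hsmall : c * k * g₀ ^ 2 ≤ 1 := by
    have h1 : g₀ ^ 2 ≤ ((c * k + 1)⁻¹) ^ 2 := pow_le_pow_left₀ hg₀pos.le hg₀inv 2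
    have h2 : c * k * ((c * k + 1)⁻¹) ^ 2 ≤ 1 := by
      rw [inv_pow, ← div_eq_mul_inv, div_le_one (by positivity)]
      nlinarith [mul_nonneg hc hk0]
    exact (mul_le_mul_of_nonneg_left h1 (mul_nonneg hc hk0)).trans h2
  have hden : (1 + c * k * g₀ ^ 2) ^ 2 ≤ 4 := by
    have hnn : 0 ≤ c * k * g₀ ^ 2 := by positivity
    nlinarith
  have hdenpos : 0 < (1 + c * k * g₀ ^ 2) ^ 2 := by positivity
  have hval : g₀ / 4 ≤ g₀ / (1 + c * k * g₀ ^ 2) ^ 2 :=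
    div_le_div_of_nonneg_left hg₀pos.le hdenpos hden
  have hmain : g₀ / 4 ≤ C * ρ ^ k := hval.trans (h k g₀ hg₀pos hg₀le)
  -- contradiction in either branch of the `min`
  rcases min_choice γ₀ (c * k + 1)⁻¹ with hm | hm
  · rw [hg₀, hm] at hmain
    linarith
  · rw [hg₀, hm] at hmain
    have : C * ρ ^ k * (c * k + 1) ≥ (c * k + 1)⁻¹ / 4 * (c * k + 1) :=
      mul_le_mul_of_nonneg_right hmain hck1.le
    rw [div_mul_eq_mul_div, inv_mul_cancel₀ hck1.ne'] at this
    linarith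

end Summit.QuantumFields.YangMills.Cruxes.EndpointGivenBR13SepCoPH.Crit2ModulusPrefactorToy
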